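import Literature.MathematicalPhysics.QuantumLattice.DWaveSource

/-!
# Crux `TwSeededEnsembleEquivalence` (stmt-HubbardSuperconductivity-1698), line `exposed-density-duality`
# (thermal member, skeleton v12) — stub `stub_thermalCloser` (STUB E), part 1: the core Chernoff + walk estimate

Abstract real analysis on particle-number sector weights `W(N; μ)` (`N ≤ 2L²`) of a grand-canonical Gibbs state with
the exponential tilt `W(N; μ') = e^{β(μ'−μ)N} W(N; μ)`, summing to `Z(μ)`:
* `walk_iter_down` / `walk_iter_up` — iterating a one-step ratio bound along the particle-number axis;
* `chernoff_tail_up` / `chernoff_tail_down` — Chernoff (exponential Markov) bounds on the tails of the number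
  distribution from a secant bound on `log Z`;
* `chernoffWalk_core` (registered sub-goal of the stub) — if the secants of `log Z` at `μ₀` with step `τ` are within
  `βL²τ((1−δ) ± η)` and the one-step ratios of `W(·; μ₀)` on `L²/2 ≤ N ≤ L²` are at most `5e^{β(|μ₀|+2C)}`, then for
  `L ≥ 20`, `η ≤ 1/20`, `L² ≥ 2/(τη)`:
  `log (Z(μ₀)/W(N_L; μ₀)) ≤ log 2 + log (2L² + 1) + (2ηL² + 2)(log 5 + β(|μ₀| + 2C))`, `N_L = 2⌊(1−δ)L²/2⌋`
  (half of `Z(μ₀)` sits on the window `|N − (1−δ)L²| < 2ηL²`; a heaviest sector there is walked to `N_L`).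

Bratteli–Robinson II §5.3 (large deviations of the particle number in a Gibbs state); folklore.
-/

set_option linter.dupNamespace false

namespace Summit.HubbardSuperconductivity.HubbardSuperconductivity.Theorems.TwSeededEnsembleEquivalence.ThermalDuality

open Matrix Finset Literature.MathematicalPhysics.QuantumLattice
open scoped ComplexOrder Matrix.Norms.L2Operator

noncomputable section

/-! ## Abstract walk iterations -/

/-- Iterating a one-step ratio bound `f n ≤ ρ f (n − 1)` downwards from `n` to `a`: `f (a + k) ≤ ρ^k f a`.
[folklore] -/
theorem walk_iter_down {f : ℕ → ℝ} {ρ : ℝ} (hρ : 0 ≤ ρ) {a b : ℕ}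
    (hstep : ∀ n, a < n → n ≤ b → f n ≤ ρ * f (n - 1)) :
    ∀ k n, n = a + k → n ≤ b → f n ≤ ρ ^ k * f a := by
  intro k
  induction k with
  | zero => intro n hn _; simp [hn]
  | succ k ih =>
    intro n hn hnb
    have h1 : f n ≤ ρ * f (n - 1) := hstep n (by omega) hnb
    have h2 : f (n - 1) ≤ ρ ^ k * f a := ih (n - 1) (by omega) (by omega)
    calc f n ≤ ρ * f (n - 1) := h1
      _ ≤ ρ * (ρ ^ k * f a) := mul_le_mul_of_nonneg_left h2 hρ
      _ = ρ ^ (k + 1) * f a := by ring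

/-- Iterating a one-step ratio bound `f n ≤ ρ f (n + 1)` upwards from `n` to `b`: `f n ≤ ρ^k f b` when `n + k = b`.
[folklore] -/
theorem walk_iter_up {f : ℕ → ℝ} {ρ : ℝ} (hρ : 0 ≤ ρ) {a b : ℕ}
    (hstep : ∀ n, a ≤ n → n < b → f n ≤ ρ * f (n + 1)) :
    ∀ k n, n + k = b → a ≤ n → f n ≤ ρ ^ k * f b := by
  intro k
  induction k with
  | zero => intro n hn _; simp [← hn]
  | succ k ih =>
    intro n hn han
    have h1 : f n ≤ ρ * f (n + 1) := hstep n han (by omega)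
    have h2 : f (n + 1) ≤ ρ ^ k * f b := ih (n + 1) (by omega) (by omega)
    calc f n ≤ ρ * f (n + 1) := h1
      _ ≤ ρ * (ρ ^ k * f b) := mul_le_mul_of_nonneg_left h2 hρ
      _ = ρ ^ (k + 1) * f b := by ring

/-! ## Abstract Chernoff tails for tilted sector weights -/

/-- CHERNOFF UPPER TAIL. If the sector weights tilt as `W(N; μ') = e^{β(μ'−μ)N} W(N; μ)`, are positive, sum to `Z`,
and `Z(μ₀ + τ) ≤ Z(μ₀) e^{B}`, then `Σ_{N ≥ ν} W(N; μ₀) ≤ Z(μ₀) e^{B − βτν}` (`βτ ≥ 0`). [folklore] -/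
theorem chernoff_tail_up {W : ℕ → ℝ → ℝ} {Z : ℝ → ℝ} {M : ℕ} {β τ μ₀ ν B : ℝ} (hβτ : 0 ≤ β * τ)
    (hZ : ∀ μ, Z μ = ∑ N ∈ Finset.range (M + 1), W N μ)
    (htilt : ∀ μ μ' N, W N μ' = Real.exp (β * (μ' - μ) * N) * W N μ)
    (hpos : ∀ μ N, N ≤ M → 0 < W N μ)
    (hsec : Z (μ₀ + τ) ≤ Z μ₀ * Real.exp B) :
    ∑ N ∈ (Finset.range (M + 1)).filter (fun N : ℕ => ν ≤ (N : ℝ)), W N μ₀ ≤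
      Z μ₀ * Real.exp (B - β * τ * ν) := by
  have hterm : ∀ N ∈ (Finset.range (M + 1)).filter (fun N : ℕ => ν ≤ (N : ℝ)),
      W N μ₀ ≤ Real.exp (-(β * τ * ν)) * W N (μ₀ + τ) := by
    intro N hN
    rw [Finset.mem_filter, Finset.mem_range] at hN
    have hWpos : 0 < W N (μ₀ + τ) := hpos _ N (by omega)
    rw [htilt (μ₀ + τ) μ₀ N]
    refine mul_le_mul_of_nonneg_right (Real.exp_le_exp.mpr ?_) hWpos.le
    have : β * (μ₀ - (μ₀ + τ)) * N = -(β * τ * N) := by ring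
    rw [this, neg_le_neg_iff]
    exact mul_le_mul_of_nonneg_left hN.2 hβτ
  have hsub : ∑ N ∈ (Finset.range (M + 1)).filter (fun N : ℕ => ν ≤ (N : ℝ)), W N (μ₀ + τ) ≤
      ∑ N ∈ Finset.range (M + 1), W N (μ₀ + τ) :=
    Finset.sum_le_sum_of_subset_of_nonneg (Finset.filter_subset _ _)
      (fun N hN _ => (hpos _ N (by rw [Finset.mem_range] at hN; omega)).le)
  calc ∑ N ∈ (Finset.range (M + 1)).filter (fun N : ℕ => ν ≤ (N : ℝ)), W N μ₀
      ≤ ∑ N ∈ (Finset.range (M + 1)).filter (fun N : ℕ => ν ≤ (N : ℝ)),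
          Real.exp (-(β * τ * ν)) * W N (μ₀ + τ) := Finset.sum_le_sum hterm
    _ = Real.exp (-(β * τ * ν)) *
          ∑ N ∈ (Finset.range (M + 1)).filter (fun N : ℕ => ν ≤ (N : ℝ)), W N (μ₀ + τ) := by
        rw [Finset.mul_sum]
    _ ≤ Real.exp (-(β * τ * ν)) * Z (μ₀ + τ) := by
        rw [hZ (μ₀ + τ)]
        exact mul_le_mul_of_nonneg_left hsub (Real.exp_pos _).le
    _ ≤ Real.exp (-(β * τ * ν)) * (Z μ₀ * Real.exp B) :=
        mul_le_mul_of_nonneg_left hsec (Real.exp_pos _).le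
    _ = Z μ₀ * Real.exp (B - β * τ * ν) := by
        rw [sub_eq_add_neg, Real.exp_add]; ring

/-- CHERNOFF LOWER TAIL. If the sector weights tilt as `W(N; μ') = e^{β(μ'−μ)N} W(N; μ)`, are positive, sum to `Z`,
and `Z(μ₀ − τ) ≤ Z(μ₀) e^{−B}`, then `Σ_{N ≤ ν} W(N; μ₀) ≤ Z(μ₀) e^{βτν − B}` (`βτ ≥ 0`). [folklore] -/
theorem chernoff_tail_down {W : ℕ → ℝ → ℝ} {Z : ℝ → ℝ} {M : ℕ} {β τ μ₀ ν B : ℝ} (hβτ : 0 ≤ β * τ)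
    (hZ : ∀ μ, Z μ = ∑ N ∈ Finset.range (M + 1), W N μ)
    (htilt : ∀ μ μ' N, W N μ' = Real.exp (β * (μ' - μ) * N) * W N μ)
    (hpos : ∀ μ N, N ≤ M → 0 < W N μ)
    (hsec : Z (μ₀ - τ) ≤ Z μ₀ * Real.exp (-B)) :
    ∑ N ∈ (Finset.range (M + 1)).filter (fun N : ℕ => (N : ℝ) ≤ ν), W N μ₀ ≤
      Z μ₀ * Real.exp (β * τ * ν - B) := by
  have hterm : ∀ N ∈ (Finset.range (M + 1)).filter (fun N : ℕ => (N : ℝ) ≤ ν),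
      W N μ₀ ≤ Real.exp (β * τ * ν) * W N (μ₀ - τ) := by
    intro N hN
    rw [Finset.mem_filter, Finset.mem_range] at hN
    have hWpos : 0 < W N (μ₀ - τ) := hpos _ N (by omega)
    rw [htilt (μ₀ - τ) μ₀ N]
    refine mul_le_mul_of_nonneg_right (Real.exp_le_exp.mpr ?_) hWpos.le
    have : β * (μ₀ - (μ₀ - τ)) * N = β * τ * N := by ring
    rw [this]
    exact mul_le_mul_of_nonneg_left hN.2 hβτ
  have hsub : ∑ N ∈ (Finset.range (M + 1)).filter (fun N : ℕ => (N : ℝ) ≤ ν), W N (μ₀ - τ) ≤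
      ∑ N ∈ Finset.range (M + 1), W N (μ₀ - τ) :=
    Finset.sum_le_sum_of_subset_of_nonneg (Finset.filter_subset _ _)
      (fun N hN _ => (hpos _ N (by rw [Finset.mem_range] at hN; omega)).le)
  calc ∑ N ∈ (Finset.range (M + 1)).filter (fun N : ℕ => (N : ℝ) ≤ ν), W N μ₀
      ≤ ∑ N ∈ (Finset.range (M + 1)).filter (fun N : ℕ => (N : ℝ) ≤ ν),
          Real.exp (β * τ * ν) * W N (μ₀ - τ) := Finset.sum_le_sum hterm
    _ = Real.exp (β * τ * ν) *
          ∑ N ∈ (Finset.range (M + 1)).filter (fun N : ℕ => (N : ℝ) ≤ ν), W N (μ₀ - τ) := by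
        rw [Finset.mul_sum]
    _ ≤ Real.exp (β * τ * ν) * Z (μ₀ - τ) := by
        rw [hZ (μ₀ - τ)]
        exact mul_le_mul_of_nonneg_left hsub (Real.exp_pos _).le
    _ ≤ Real.exp (β * τ * ν) * (Z μ₀ * Real.exp (-B)) :=
        mul_le_mul_of_nonneg_left hsec (Real.exp_pos _).le
    _ = Z μ₀ * Real.exp (β * τ * ν - B) := by
        rw [sub_eq_add_neg, Real.exp_add]; ring

/-! ## The core estimate: Chernoff window + walk -/

/-- THE CORE ESTIMATE (abstract, per volume). Let `W(N; μ)` (`N ≤ 2L²`) be positive weights summing to `Z(μ)` with the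
exponential tilt `W(N; μ') = e^{β(μ'−μ)N} W(N; μ)`, whose one-step ratios at `μ₀` on `L²/2 ≤ N ≤ L²` are at most
`5e^{β(|μ₀|+2C)}` (the thermal one-particle walk transported to `μ₀`, `walk_ratio_down/up`), and
suppose the secants of `log Z` at `μ₀` with step `τ` are within `βL²τ((1−δ) ± η)`. If `L ≥ 20`, `η ≤ 1/20` and
`L² ≥ 2/(τη)`, then `log (Z(μ₀)/W(N_L; μ₀)) ≤ log 2 + log (2L² + 1) + (2ηL² + 2)(log 5 + β(|μ₀| + 2C))`,
`N_L = 2⌊(1−δ)L²/2⌋`. [folklore] -/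
theorem chernoffWalk_core :
    ∀ {W : ℕ → ℝ → ℝ} {Z : ℝ → ℝ} (L : ℕ) {β C μ₀ τ η δ : ℝ}, 20 ≤ L → 1 ≤ β → 0 ≤ C → 0 < τ → 0 < η →
      η ≤ 1 / 20 → δ ∈ Set.Icc (1 / 10 : ℝ) (2 / 5 : ℝ) →
      (∀ μ, Z μ = ∑ N ∈ Finset.range (2 * L ^ 2 + 1), W N μ) →
      (∀ μ μ' N, W N μ' = Real.exp (β * (μ' - μ) * N) * W N μ) →
      (∀ μ N, N ≤ 2 * L ^ 2 → 0 < W N μ) →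
      (∀ n : ℕ, (L : ℝ) ^ 2 / 2 ≤ n → 1 ≤ n → n ≤ 2 * L ^ 2 →
        W n μ₀ ≤ 5 * Real.exp (β * (|μ₀| + 2 * C)) * W (n - 1) μ₀) →
      (∀ n : ℕ, (n : ℝ) ≤ (L : ℝ) ^ 2 → n + 1 ≤ 2 * L ^ 2 →
        W n μ₀ ≤ 5 * Real.exp (β * (|μ₀| + 2 * C)) * W (n + 1) μ₀) →
      Real.log (Z (μ₀ + τ)) - Real.log (Z μ₀) ≤ β * (L : ℝ) ^ 2 * τ * ((1 - δ) + η) →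
      β * (L : ℝ) ^ 2 * τ * ((1 - δ) - η) ≤ Real.log (Z μ₀) - Real.log (Z (μ₀ - τ)) →
      2 / (τ * η) ≤ (L : ℝ) ^ 2 →
      Real.log (Z μ₀ / W (2 * ⌊(1 - δ) * (L : ℝ) ^ 2 / 2⌋₊) μ₀) ≤
        Real.log 2 + Real.log (2 * (L : ℝ) ^ 2 + 1) +
          (2 * η * (L : ℝ) ^ 2 + 2) * (Real.log 5 + β * (|μ₀| + 2 * C)) := by
  intro W Z L β C μ₀ τ η δ hL hβ hC hτ hη hη' hδ hZ htilt hpos hstep_down hstep_up hsec_up hsec_dn hLτη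
  obtain ⟨hδ₁, hδ₂⟩ := hδ
  have hβ0 : 0 < β := by linarith
  have hL' : (20 : ℝ) ≤ L := by exact_mod_cast hL
  have hV400 : (400 : ℝ) ≤ (L : ℝ) ^ 2 := by nlinarith
  -- basic quantities
  set V : ℝ := (L : ℝ) ^ 2 with hVdef
  set M : ℕ := 2 * L ^ 2 with hMdef
  set NL : ℕ := 2 * ⌊(1 - δ) * V / 2⌋₊ with hNLdef
  set ρ : ℝ := 5 * Real.exp (β * (|μ₀| + 2 * C)) with hρdef
  have hVpos : 0 < V := by linarith
  have hMV : (M : ℝ) = 2 * V := by rw [hMdef, hVdef]; push_cast; ring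
  have hβτ : 0 ≤ β * τ := by positivity
  have hδV₁ : 3 / 5 * V ≤ (1 - δ) * V := by
    have := mul_nonneg (show 0 ≤ 2 / 5 - δ by linarith) hVpos.le
    linarith
  have hδV₂ : (1 - δ) * V ≤ 9 / 10 * V := by
    have := mul_nonneg (show 0 ≤ δ - 1 / 10 by linarith) hVpos.le
    linarith
  have hηV : 2 * η * V ≤ V / 10 := by
    have := mul_nonneg (show 0 ≤ 1 / 20 - η by linarith) hVpos.le
    linarith
  -- N_L
  have hNL_le : (NL : ℝ) ≤ (1 - δ) * V := by
    have h := Nat.floor_le (show 0 ≤ (1 - δ) * V / 2 by linarith)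
    rw [hNLdef]; push_cast; linarith
  have hNL_gt : (1 - δ) * V - 2 < NL := by
    have h := Nat.lt_floor_add_one ((1 - δ) * V / 2)
    rw [hNLdef]; push_cast; linarith
  have hNL_le_M : NL ≤ M := by
    have : (NL : ℝ) ≤ M := by rw [hMV]; linarith
    exact_mod_cast this
  -- positivity of Z
  have hZpos : ∀ μ, 0 < Z μ := by
    intro μ
    rw [hZ μ]
    exact Finset.sum_pos (fun N hN => hpos μ N (by rw [Finset.mem_range] at hN; omega)) ⟨0, by simp⟩
  -- Chernoff tails
  have hsecU : Z (μ₀ + τ) ≤ Z μ₀ * Real.exp (β * V * τ * ((1 - δ) + η)) := by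
    have h1 : Real.log (Z (μ₀ + τ)) ≤ Real.log (Z μ₀) + β * V * τ * ((1 - δ) + η) := by linarith
    calc Z (μ₀ + τ) = Real.exp (Real.log (Z (μ₀ + τ))) := (Real.exp_log (hZpos _)).symm
      _ ≤ Real.exp (Real.log (Z μ₀) + β * V * τ * ((1 - δ) + η)) := Real.exp_le_exp.mpr h1
      _ = Z μ₀ * Real.exp (β * V * τ * ((1 - δ) + η)) := by rw [Real.exp_add, Real.exp_log (hZpos _)]
  have hsecD : Z (μ₀ - τ) ≤ Z μ₀ * Real.exp (-(β * V * τ * ((1 - δ) - η))) := by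
    have h1 : Real.log (Z (μ₀ - τ)) ≤ Real.log (Z μ₀) + -(β * V * τ * ((1 - δ) - η)) := by linarith
    calc Z (μ₀ - τ) = Real.exp (Real.log (Z (μ₀ - τ))) := (Real.exp_log (hZpos _)).symm
      _ ≤ Real.exp (Real.log (Z μ₀) + -(β * V * τ * ((1 - δ) - η))) := Real.exp_le_exp.mpr h1
      _ = Z μ₀ * Real.exp (-(β * V * τ * ((1 - δ) - η))) := by
          rw [Real.exp_add, Real.exp_log (hZpos _)]
  have htailU := chernoff_tail_up (ν := (1 - δ + 2 * η) * V) hβτ hZ htilt hpos hsecU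
  have htailD := chernoff_tail_down (ν := (1 - δ - 2 * η) * V) hβτ hZ htilt hpos hsecD
  have hexpU : β * V * τ * ((1 - δ) + η) - β * τ * ((1 - δ + 2 * η) * V) = -(β * τ * η * V) := by ring
  have hexpD : β * τ * ((1 - δ - 2 * η) * V) - β * V * τ * ((1 - δ) - η) = -(β * τ * η * V) := by ring
  rw [hexpU] at htailU
  rw [hexpD] at htailD
  -- the small factor
  have hsmall : Real.exp (-(β * τ * η * V)) ≤ 1 / 4 := by
    have hq : Real.exp (-2) ≤ 1 / 4 := by
      have h5 : (5 : ℝ) ≤ Real.exp 2 := by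
        have := Real.quadratic_le_exp_of_nonneg (show (0 : ℝ) ≤ 2 by norm_num)
        norm_num at this
        linarith
      rw [Real.exp_neg, inv_le_comm₀ (Real.exp_pos _) (by norm_num)]
      linarith
    refine le_trans (Real.exp_le_exp.mpr ?_) hq
    rw [neg_le_neg_iff]
    have h1 : 2 ≤ τ * η * V := by
      have := (div_le_iff₀ (by positivity : 0 < τ * η)).mp hLτη
      linarith
    have h2 : τ * η * V ≤ β * τ * η * V := by
      have : 0 ≤ τ * η * V := by positivity
      nlinarith
    linarith
  -- the window
  set s := Finset.range (M + 1) with hsdef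
  set S := (s.filter (fun N : ℕ => ¬ ((N : ℝ) ≤ (1 - δ - 2 * η) * V))).filter
    (fun N : ℕ => ¬ ((1 - δ + 2 * η) * V ≤ (N : ℝ))) with hSdef
  have hmem_s : ∀ N, N ∈ s → N ≤ M := fun N hN => by
    rw [hsdef, Finset.mem_range] at hN; omega
  have hsplit : Z μ₀ ≤ ∑ N ∈ s.filter (fun N : ℕ => (N : ℝ) ≤ (1 - δ - 2 * η) * V), W N μ₀ +
      ∑ N ∈ s.filter (fun N : ℕ => (1 - δ + 2 * η) * V ≤ (N : ℝ)), W N μ₀ + ∑ N ∈ S, W N μ₀ := by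
    rw [hZ μ₀, ← Finset.sum_filter_add_sum_filter_not s (fun N : ℕ => (N : ℝ) ≤ (1 - δ - 2 * η) * V),
      ← Finset.sum_filter_add_sum_filter_not (s.filter (fun N : ℕ => ¬ ((N : ℝ) ≤ (1 - δ - 2 * η) * V)))
        (fun N : ℕ => (1 - δ + 2 * η) * V ≤ (N : ℝ)), ← hSdef]
    have hmid : ∑ N ∈ (s.filter (fun N : ℕ => ¬ ((N : ℝ) ≤ (1 - δ - 2 * η) * V))).filter
        (fun N : ℕ => (1 - δ + 2 * η) * V ≤ (N : ℝ)), W N μ₀ ≤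
        ∑ N ∈ s.filter (fun N : ℕ => (1 - δ + 2 * η) * V ≤ (N : ℝ)), W N μ₀ := by
      apply Finset.sum_le_sum_of_subset_of_nonneg
      · intro N hN
        simp only [Finset.mem_filter] at hN ⊢
        exact ⟨hN.1.1, hN.2⟩
      · intro N hN _
        rw [Finset.mem_filter] at hN
        exact (hpos μ₀ N (hmem_s N hN.1)).le
    linarith
  have hmid_ge : Z μ₀ / 2 ≤ ∑ N ∈ S, W N μ₀ := by
    have hZ0 := (hZpos μ₀).le
    have h1 : ∑ N ∈ s.filter (fun N : ℕ => (N : ℝ) ≤ (1 - δ - 2 * η) * V), W N μ₀ ≤ Z μ₀ * (1 / 4) :=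
      htailD.trans (mul_le_mul_of_nonneg_left hsmall hZ0)
    have h2 : ∑ N ∈ s.filter (fun N : ℕ => (1 - δ + 2 * η) * V ≤ (N : ℝ)), W N μ₀ ≤ Z μ₀ * (1 / 4) :=
      htailU.trans (mul_le_mul_of_nonneg_left hsmall hZ0)
    linarith
  -- a heavy sector N* in the window
  have hSne : S.Nonempty := by
    by_contra hne
    rw [Finset.not_nonempty_iff_eq_empty] at hne
    rw [hne, Finset.sum_empty] at hmid_ge
    linarith [hZpos μ₀]
  obtain ⟨Ns, hNsS, hNsmax⟩ := Finset.exists_max_image S (fun N => W N μ₀) hSne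
  have hSsub : S ⊆ s := (Finset.filter_subset _ _).trans (Finset.filter_subset _ _)
  have hScard : (S.card : ℝ) ≤ 2 * V + 1 := by
    have h1 : S.card ≤ s.card := Finset.card_le_card hSsub
    rw [hsdef, Finset.card_range] at h1
    have h2 : (S.card : ℝ) ≤ ((M + 1 : ℕ) : ℝ) := by exact_mod_cast h1
    rw [Nat.cast_add, hMV] at h2
    simpa using h2
  have hNs_s : Ns ∈ s := hSsub hNsS
  have hNs_le_M : Ns ≤ M := hmem_s Ns hNs_s
  have hWNs : 0 < W Ns μ₀ := hpos μ₀ Ns hNs_le_M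
  have hNs_ge : Z μ₀ / (2 * (2 * V + 1)) ≤ W Ns μ₀ := by
    have h1 : ∑ N ∈ S, W N μ₀ ≤ S.card • W Ns μ₀ := Finset.sum_le_card_nsmul _ _ _ hNsmax
    rw [nsmul_eq_mul] at h1
    rw [div_le_iff₀ (by positivity)]
    calc Z μ₀ = 2 * (Z μ₀ / 2) := by ring
      _ ≤ 2 * (S.card * W Ns μ₀) := by linarith
      _ ≤ 2 * ((2 * V + 1) * W Ns μ₀) := by
          have := mul_le_mul_of_nonneg_right hScard hWNs.le
          linarith
      _ = W Ns μ₀ * (2 * (2 * V + 1)) := by ring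
  -- where N* sits
  have hNs_lo : (1 - δ - 2 * η) * V < Ns := by
    simp only [hSdef, Finset.mem_filter, not_le] at hNsS
    exact hNsS.1.2
  have hNs_hi : (Ns : ℝ) < (1 - δ + 2 * η) * V := by
    simp only [hSdef, Finset.mem_filter, not_le] at hNsS
    exact hNsS.2
  -- the walk ratio
  have hρ1 : 1 ≤ ρ := by
    have : 1 ≤ Real.exp (β * (|μ₀| + 2 * C)) := Real.one_le_exp (by positivity)
    rw [hρdef]; linarith
  have hρ0 : 0 ≤ ρ := by linarith
  have hlogρ : Real.log ρ = Real.log 5 + β * (|μ₀| + 2 * C) := by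
    rw [hρdef, Real.log_mul (by norm_num) (Real.exp_pos _).ne', Real.log_exp]
  have hlogρ0 : 0 ≤ Real.log ρ := Real.log_nonneg hρ1
  -- walk from N* to N_L
  have hWNL : 0 < W NL μ₀ := hpos μ₀ NL hNL_le_M
  have hwalk : ∃ k : ℕ, (k : ℝ) ≤ 2 * η * V + 2 ∧ W Ns μ₀ ≤ ρ ^ k * W NL μ₀ := by
    rcases le_or_gt NL Ns with hle | hlt
    · refine ⟨Ns - NL, ?_, ?_⟩
      · rw [Nat.cast_sub hle]; linarith
      · refine walk_iter_down (f := fun N => W N μ₀) hρ0 (a := NL) (b := M) ?_ (Ns - NL) Ns (by omega) hNs_le_M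
        intro n hn hnM
        have hnr : (NL : ℝ) + 1 ≤ n := by exact_mod_cast hn
        exact hstep_down n (by linarith) (by omega) hnM
    · refine ⟨NL - Ns, ?_, ?_⟩
      · rw [Nat.cast_sub hlt.le]; linarith
      · refine walk_iter_up (f := fun N => W N μ₀) hρ0 (a := 0) (b := NL) ?_ (NL - Ns) Ns (by omega) (Nat.zero_le _)
        intro n _ hn
        have hnr : (n : ℝ) + 1 ≤ NL := by exact_mod_cast hn
        exact hstep_up n (by linarith) (by omega)
  obtain ⟨k, hk, hWk⟩ := hwalk
  -- assemble
  have hρk : ρ ^ k ≤ Real.exp ((2 * η * V + 2) * Real.log ρ) := by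
    rw [← Real.rpow_natCast, Real.rpow_def_of_pos (by linarith)]
    apply Real.exp_le_exp.mpr
    rw [mul_comm]
    exact mul_le_mul_of_nonneg_right hk hlogρ0
  have hmain : Z μ₀ / W NL μ₀ ≤ 2 * (2 * V + 1) * Real.exp ((2 * η * V + 2) * Real.log ρ) := by
    rw [div_le_iff₀ hWNL]
    have h1 : Z μ₀ ≤ 2 * (2 * V + 1) * W Ns μ₀ := by
      have := (div_le_iff₀ (by positivity : (0 : ℝ) < 2 * (2 * V + 1))).mp hNs_ge
      linarith
    calc Z μ₀ ≤ 2 * (2 * V + 1) * W Ns μ₀ := h1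
      _ ≤ 2 * (2 * V + 1) * (ρ ^ k * W NL μ₀) := by
          apply mul_le_mul_of_nonneg_left hWk; positivity
      _ ≤ 2 * (2 * V + 1) * (Real.exp ((2 * η * V + 2) * Real.log ρ) * W NL μ₀) := by
          apply mul_le_mul_of_nonneg_left (mul_le_mul_of_nonneg_right hρk hWNL.le); positivity
      _ = 2 * (2 * V + 1) * Real.exp ((2 * η * V + 2) * Real.log ρ) * W NL μ₀ := by ring
  have hpos' : 0 < Z μ₀ / W NL μ₀ := div_pos (hZpos μ₀) hWNL
  calc Real.log (Z μ₀ / W NL μ₀)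
      ≤ Real.log (2 * (2 * V + 1) * Real.exp ((2 * η * V + 2) * Real.log ρ)) :=
        Real.log_le_log hpos' hmain
    _ = Real.log 2 + Real.log (2 * V + 1) + (2 * η * V + 2) * Real.log ρ := by
        rw [Real.log_mul (by positivity) (Real.exp_pos _).ne', Real.log_mul (by norm_num) (by positivity),
          Real.log_exp]
    _ = Real.log 2 + Real.log (2 * V + 1) + (2 * η * V + 2) * (Real.log 5 + β * (|μ₀| + 2 * C)) := by
        rw [hlogρ]

end

end Summit.HubbardSuperconductivity.HubbardSuperconductivity.Theorems.TwSeededEnsembleEquivalence.ThermalDuality
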